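import Summits.BirchSwinnertonDyer.BirchSwinnertonDyer.Theorems.ThetaPartnerAtTwoSignedKatoUpToAtTwoCuspFactorEvaluation
import Literature.NumberTheory.EllipticCurves.PAdicPowerSeriesCharacterEvaluationProofs
import HarnessLib

/-!
# Route `ThetaPartnerAtTwo` (TP2), crux K3 `SignedKatoDivisibilityUpToAtTwo` (stmt-BirchSwinnertonDyer-20308 / K3P′ 25631), line
# `colemanrat` v12/v13 — the CHARACTER VALUE of the avatar `U_c = (1+T)^{ℓ(⟨c⟩)}`: `U_c(χ) = χ(c)` for even `χ` (brick B1, evaluation clause)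

Width seat `bsd-wall-tp2-p2x-w2` g6 (cell `bsd-wall`). HONEST FRAMING: theorems only (no definition, no named fact, no instance, no
`sorry`); closes no item; K3 / K3P′ are NOT settled and BSD is NOT proved by any of this.

## Why (lead memo `G7-ASSEMBLY-v1.md` §0.5 «`U_c(χ) = χ(c)` (NO bar)»; memo `W2G6-KATO1312-AT2.md` §3)

In the per-character reading of the four-term cusp element of `CuspEval.exists_cuspElement_not_mem` one needs the value of
`(1+T)^{ℓ(u)} = PowerSeries.binomialSeries ℤ_[2] (CyclotomicZp.ell 2 u)` (`u = ⟨c⟩` the `2`-adic unit of the odd natural `c`) at `T = χ(5) − 1`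
for an EVEN Dirichlet character `χ` modulo `2^n` of `2`-power order: it is `χ(c)`. The tree gives `(1+T)^e(χ(5)−1) = χ(5^e mod 2^n)`
(`hasSum_cpCoeff_binomialSeries_character`) for every `e ∈ ℤ₂`, and `5^{ℓ(u)} = ±u` (`= u` if `u ≡ 1 (4)`, `= −u` if `u ≡ 3 (4)`: `ℓ` is defined
through squares, `5^{2ℓ(u)} = u²`); evenness of `χ` absorbs the sign. THIS FILE: `cycPow_ell_eq_self_or_neg`, `apply_toZModPow_cycPow_ell`
(`χ(5^{ℓ(u)}) = χ(u)` for even `χ`), and **`hasSum_binomialSeries_ell_character`** (`(1+T)^{ℓ(u)}(χ(5)−1) = χ(c)` for `↑u = c`).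

References: [Washington1997] §7.2; [MazurTateTeitelbaum1986Invent] §I.13; [Kato2004Asterisque] §13.12.
-/

set_option autoImplicit false
-- the Theorems namespace of this sub repeats the summit name by design (D-0017 nested layout)
set_option linter.dupNamespace false

noncomputable section

open scoped BigOperators

open Literature.NumberTheory.EllipticCurves Literature.NumberTheory.EllipticCurves.CyclotomicZp
  Literature.NumberTheory.EllipticCurves.PadicOneUnits

namespace Summit.BirchSwinnertonDyer.BirchSwinnertonDyer.Theorems.SignedKatoOffTwo.CuspEval

/-- **`5^{ℓ(u)} = ±u`** for a `2`-adic unit `u`: `= u` if `u ≡ 1 (mod 4)`, `= −u` if `u ≡ 3 (mod 4)` (`ℓ(−1) = 0`, and on `1 + 4ℤ₂` the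
normalised logarithm inverts `a ↦ 5^a`, prequel `cycPow_ell_eq_of_norm_sub_one_le`). [cite: Washington1997, §7.2] -/
theorem cycPow_ell_eq_self_or_neg (u : ℤ_[2]ˣ) : cycPow 2 (ell 2 u) = u ∨ cycPow 2 (ell 2 u) = -(u : ℤ_[2]) := by
  -- `u mod 4 ∈ {1, -1}`
  have hdec : ∀ v : (ZMod (2 ^ 2))ˣ, (v : ZMod (2 ^ 2)) = 1 ∨ (v : ZMod (2 ^ 2)) = -1 := by decide
  have hq : ((2 : ℕ) : ℤ_[2]) = 2 := by norm_num
  -- norm bound from divisibility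
  have hbound : ∀ w : ℤ_[2]ˣ, (PadicInt.toZModPow 2 : ℤ_[2] →+* ZMod (2 ^ 2)) (w : ℤ_[2]) = 1 →
      ‖(w : ℤ_[2]) - 1‖ ≤ ‖(2 : ℤ_[2]) ^ 2‖ := by
    intro w hw
    have hmem : (w : ℤ_[2]) - 1 ∈ RingHom.ker (PadicInt.toZModPow 2 : ℤ_[2] →+* ZMod (2 ^ 2)) := by
      rw [RingHom.mem_ker, map_sub, map_one, hw, sub_self]
    rw [PadicInt.ker_toZModPow, Ideal.mem_span_singleton] at hmem
    obtain ⟨b, hb⟩ := hmem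
    rw [hb, norm_mul, hq]
    exact mul_le_of_le_one_right (norm_nonneg _) (PadicInt.norm_le_one b)
  rcases hdec (Units.map (PadicInt.toZModPow 2 : ℤ_[2] →+* ZMod (2 ^ 2)).toMonoidHom u) with h1 | h1
  · exact Or.inl (cycPow_ell_eq_of_norm_sub_one_le u (hbound u h1))
  · right
    have hneg : (PadicInt.toZModPow 2 : ℤ_[2] →+* ZMod (2 ^ 2)) ((-u : ℤ_[2]ˣ) : ℤ_[2]) = 1 := by
      have h1' : (PadicInt.toZModPow 2 : ℤ_[2] →+* ZMod (2 ^ 2)) (u : ℤ_[2]) = -1 := h1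
      rw [Units.val_neg, map_neg, h1', neg_neg]
    have hcyc := cycPow_ell_eq_of_norm_sub_one_le (-u) (hbound (-u) hneg)
    have hell : ell 2 (-u) = ell 2 u := by
      rw [← neg_one_mul, ell_mul, (ell_eq_zero_iff 2 (-1)).mpr (isOfFinOrder_iff_pow_eq_one.mpr ⟨2, by norm_num, neg_one_sq⟩),
        zero_add]
    rw [← hell, hcyc, Units.val_neg]

/-- **An even character does not see the sign**: for an EVEN Dirichlet character `χ` modulo `2^n` and a `2`-adic unit `u`,
`χ(5^{ℓ(u)} mod 2^n) = χ(u mod 2^n)`. [cite: Washington1997, §7.2] -/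
theorem apply_toZModPow_cycPow_ell {R : Type*} [CommRing R] {n : ℕ} (χ : DirichletCharacter R (2 ^ n)) (hχ : χ.Even)
    (u : ℤ_[2]ˣ) :
    χ ((PadicInt.toZModPow n : ℤ_[2] →+* ZMod (2 ^ n)) (cycPow 2 (ell 2 u))) =
      χ ((PadicInt.toZModPow n : ℤ_[2] →+* ZMod (2 ^ n)) (u : ℤ_[2])) := by
  rcases cycPow_ell_eq_self_or_neg u with h | h
  · rw [h]
  · rw [h, map_neg, ← neg_one_mul, map_mul, hχ, one_mul]

/-- **`U_c(χ) = χ(c)`**: for an EVEN Dirichlet character `χ` modulo `2^n` of `2`-power order with values in `ℂ₂`, a `2`-adic unit `u` with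
`↑u = c` (`c` an odd natural) and the avatar `(1+T)^{ℓ(u)} = PowerSeries.binomialSeries ℤ_[2] (ell 2 u)`:
`∑_k ι((ℓ(u) choose k))·(χ(5) − 1)^k = χ(c)` (tree `hasSum_cpCoeff_binomialSeries_character` + `apply_toZModPow_cycPow_ell`). This is the
evaluation clause of brick B1 (lead memo G7-ASSEMBLY-v1 §0.5). [cite: MazurTateTeitelbaum1986Invent, §I.13] -/
theorem hasSum_binomialSeries_ell_character {n : ℕ} (χ : DirichletCharacter ℂ_[2] (2 ^ n)) (hχ : χ.Even)
    (hord : ∃ j : ℕ, orderOf χ = 2 ^ j) (u : ℤ_[2]ˣ) {c : ℕ} (hu : (u : ℤ_[2]) = c) :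
    HasSum (fun k ↦ ((algebraMap ℚ_[2] ℂ_[2]).comp (algebraMap ℤ_[2] ℚ_[2]))
        (PowerSeries.coeff k (PowerSeries.binomialSeries ℤ_[2] (ell 2 u))) *
          (χ (cyclotomicGenerator 2 : ZMod (2 ^ n)) - 1) ^ k)
      (χ (c : ZMod (2 ^ n))) := by
  have h := hasSum_cpCoeff_binomialSeries_character (p := 2) χ hord (ell 2 u)
  rwa [apply_toZModPow_cycPow_ell χ hχ u, hu, map_natCast (PadicInt.toZModPow n : ℤ_[2] →+* ZMod (2 ^ n)) c] at h

/-- The same with an exponent twist `η = −1` (the inverse avatar `(1+T)^{−ℓ(u)}`): value `χ(c)⁻¹ = χ̄(c)`. [cite: MazurTateTeitelbaum1986Invent, §I.13] -/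
theorem hasSum_binomialSeries_neg_ell_character {n : ℕ} (χ : DirichletCharacter ℂ_[2] (2 ^ n)) (hχ : χ.Even)
    (hord : ∃ j : ℕ, orderOf χ = 2 ^ j) (u : ℤ_[2]ˣ) {c : ℕ} (hu : (u : ℤ_[2]) = c) :
    HasSum (fun k ↦ ((algebraMap ℚ_[2] ℂ_[2]).comp (algebraMap ℤ_[2] ℚ_[2]))
        (PowerSeries.coeff k (PowerSeries.binomialSeries ℤ_[2] (-ell 2 u))) *
          (χ (cyclotomicGenerator 2 : ZMod (2 ^ n)) - 1) ^ k)
      (χ⁻¹ (c : ZMod (2 ^ n))) := by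
  have h := hasSum_cpCoeff_binomialSeries_character (p := 2) χ hord (-ell 2 u)
  have hinv : -ell 2 u = ell 2 u⁻¹ := by
    have := ell_mul 2 u u⁻¹
    rw [mul_inv_cancel, ell_one] at this
    linear_combination this
  rw [hinv, apply_toZModPow_cycPow_ell χ hχ u⁻¹] at h
  set F : ℤ_[2] →+* ZMod (2 ^ n) := PadicInt.toZModPow n with hF
  set U : (ZMod (2 ^ n))ˣ := Units.map F.toMonoidHom u with hUdef
  have hcU : (c : ZMod (2 ^ n)) = (U : ZMod (2 ^ n)) := by
    show (c : ZMod (2 ^ n)) = F (u : ℤ_[2])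
    rw [hu, map_natCast]
  have hUinv : F ((u⁻¹ : ℤ_[2]ˣ) : ℤ_[2]) = ((U⁻¹ : (ZMod (2 ^ n))ˣ) : ZMod (2 ^ n)) := by
    rw [hUdef, ← map_inv]; rfl
  rw [hcU, MulChar.inv_apply, Ring.inverse_unit, ← hUinv, hinv]
  exact h

end Summit.BirchSwinnertonDyer.BirchSwinnertonDyer.Theorems.SignedKatoOffTwo.CuspEval

end
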